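import Mathlib.RingTheory.Derivation.Basic
import Mathlib.Algebra.BigOperators.NatAntidiagonal
import Mathlib.Algebra.BigOperators.Fin
import Mathlib.Data.Pi.Interval
import Mathlib.Data.Fin.Tuple.Finset
import HarnessLib

/-!
# Iterated Leibniz rule for ordered monomials in several derivations ([BDGIL24, Lemma 5.9]) —
# PROVED (`BergEtAl2024.derivation_pow_apply_mul`, `BergEtAl2024.lemma_5_9`)

[BDGIL24] = M. van den Berg, P. Dutta, F. Gesmundo, C. Ikenmeyer, V. Lysikov, *Algebraic
metacomplexity and representation theory*, arXiv:2411.03444, §5.2 (p.28–29, PDF pp.29–30).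
For an ordered basis `X₁, …, X_K` of `gl_k` and a multi-index `i ∈ ℕ^K` the PBW monomial is
`X^i := X₁^{i₁} ⋯ X_K^{i_K} ∈ U(gl_k)`; `i' ≤ i` is the componentwise order and
`binom(i, i') := ∏_r binom(i_r, i'_r)` (p0029.txt:L31–L40).

> By Claim 4.2, any element `X ∈ U(gl_k)` acts as a derivation on the space of metapolynomials
> […]. **Lemma 5.9.** Suppose `Φ, Γ` are metapolynomials. Then
> 1. `X^i.(Φ + Γ) = X^i.Φ + X^i.Γ`;
> 2. `X^i.(ΦΓ) = Σ_{i' ≤ i} binom(i, i') (X^{i'}.Φ)(X^{i − i'}.Γ)`.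
>
> *Proof.* Item 1 follows directly from linearity. Since `gl_k` acts by derivations we have
> `X.(fg) = (X.f) g + f (X.g)`. For `i ∈ ℕ` a straightforward induction argument shows
> `X^i.(fg) = Σ_{i' ≤ i} binom(i, i') (X^{i'}.f)(X^{i−i'}.g)`. The claim follows by applying this
> formula repeatedly.

## Tree rendering (no definitions)

The statement only uses that the `X_r` act as derivations, so it is typed for an arbitrary
finite ordered family `D : Fin K → Derivation R A A` of derivations of a commutative algebra `A`
over a commutative ring `R` (the paper: `A` = metapolynomials over `ℂ`, `D r` = the action of the
`r`-th basis element of `gl_k`, Claim 4.2). The ordered monomial `X^i`, `i : Fin K → ℕ`, is the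
ordered product `(List.ofFn fun r => (D r)^(i r)).prod` in `Module.End R A` (first factor
outermost), `i' ≤ i` is `i' ∈ Finset.Iic i` (product order on `Fin K → ℕ`), and `i − i'` is the
pointwise difference.

* `derivation_pow_apply_mul` — one derivation: `D^n (ab) = Σ_{p+q=n} binom(n,p) (D^p a)(D^q b)`
  (the "straightforward induction");
* `sum_piFinset_succ` — bookkeeping: a sum over a box of multi-indices in `ℕ^{K+1}` is a double
  sum over the first coordinate and the remaining box;
* **`lemma_5_9`** — item 2 as printed, for every `K`, by induction on `K` ("applying this formula
  repeatedly"); `lemma_5_9_add` — item 1 (linearity).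

Honest framing: commutative algebra; this is the algebraic half of the circuit transformation
Thm. 5.10 (not typed: it needs the `U(gl_k)` action on metapolynomials and gate surgery on
circuits). Nothing here bears on `VP ≠ VNP`.

## References
* [BergEtAl2024] arXiv:2411.03444, Lemma 5.9, p.28 (PDF p.29), p0029.txt:L41–L80.
-/

noncomputable section

open Finset

namespace Literature.Barriers.ValiantsHypothesis

namespace BergEtAl2024

section OneDerivation

variable {R A : Type*} [CommRing R] [CommRing A] [Algebra R A]

/-- **Iterated Leibniz rule for one derivation**: `D^n (ab) = Σ_{p+q=n} binom(n,p) (D^p a)(D^q b)`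
("for `i ∈ ℕ` a straightforward induction argument shows …").
[cite: BergEtAl2024, Lemma 5.9 (proof), p.28 (PDF p.29)] locator: paper:arxiv-2411.03444 p0029.txt:L70–L80 -/
theorem derivation_pow_apply_mul (D : Derivation R A A) (n : ℕ) (a b : A) :
    ((D : Module.End R A) ^ n) (a * b) =
      ∑ pq ∈ antidiagonal n, n.choose pq.1 •
        (((D : Module.End R A) ^ pq.1) a * ((D : Module.End R A) ^ pq.2) b) := by
  set E : Module.End R A := (D : Module.End R A) with hE
  have hEapp : ∀ x : A, E x = D x := fun x => rfl
  induction n with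
  | zero => simp
  | succ n ih =>
    -- apply `D` once more to the expansion of `D^n (ab)`
    have hstep : (E ^ (n + 1)) (a * b) =
        (∑ pq ∈ antidiagonal n, n.choose pq.1 • ((E ^ (pq.1 + 1)) a * (E ^ pq.2) b)) +
          ∑ pq ∈ antidiagonal n, n.choose pq.1 • ((E ^ pq.1) a * (E ^ (pq.2 + 1)) b) := by
      rw [pow_succ', Module.End.mul_apply, ih, map_sum, ← sum_add_distrib]
      refine sum_congr rfl fun pq _ => ?_
      rw [map_nsmul, ← smul_add, hEapp, Derivation.leibniz, smul_eq_mul, smul_eq_mul, pow_succ',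
        pow_succ', Module.End.mul_apply, Module.End.mul_apply, hEapp, hEapp, add_comm,
        mul_comm ((E ^ pq.2) b)]
    -- Pascal's rule on the target
    have hsplit : ∑ pq ∈ antidiagonal (n + 1), (n + 1).choose pq.1 •
          ((E ^ pq.1) a * (E ^ pq.2) b) =
        (E ^ 0) a * (E ^ (n + 1)) b +
          ((∑ pq ∈ antidiagonal n, n.choose pq.1 • ((E ^ (pq.1 + 1)) a * (E ^ pq.2) b)) +
            ∑ pq ∈ antidiagonal n, n.choose (pq.1 + 1) • ((E ^ (pq.1 + 1)) a * (E ^ pq.2) b)) := by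
      rw [Nat.sum_antidiagonal_succ]
      simp only [Nat.choose_zero_right, one_smul, Nat.choose_succ_succ', add_smul, sum_add_distrib]
    -- the second sum of `hstep`, split at both ends
    have hkey : ∑ pq ∈ antidiagonal n, n.choose pq.1 • ((E ^ pq.1) a * (E ^ (pq.2 + 1)) b) =
        (E ^ 0) a * (E ^ (n + 1)) b +
          ∑ pq ∈ antidiagonal n, n.choose (pq.1 + 1) • ((E ^ (pq.1 + 1)) a * (E ^ pq.2) b) := by
      have h1 := Nat.sum_antidiagonal_succ' (n := n)
        (f := fun pq : ℕ × ℕ => n.choose pq.1 • ((E ^ pq.1) a * (E ^ pq.2) b))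
      have h2 := Nat.sum_antidiagonal_succ (n := n)
        (f := fun pq : ℕ × ℕ => n.choose pq.1 • ((E ^ pq.1) a * (E ^ pq.2) b))
      simp only [Nat.choose_succ_self, zero_smul, zero_add] at h1
      simp only [Nat.choose_zero_right, one_smul] at h2
      rw [← h1, h2]
    rw [hstep, hsplit, hkey]
    abel

end OneDerivation

section Bookkeeping

/-- Bookkeeping for the induction over the number of derivations: a sum over a box
`piFinset S ⊆ (Fin (K+1) → ℕ)` is the double sum over the first coordinate and the box of tails.
[folklore] -/
private theorem sum_piFinset_succ {M : Type*} [AddCommMonoid M] {K : ℕ} {α : Type*}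
    [DecidableEq α] (S : Fin (K + 1) → Finset α) (F : (Fin (K + 1) → α) → M) :
    ∑ j ∈ Fintype.piFinset S, F j =
      ∑ x ∈ S 0, ∑ t ∈ Fintype.piFinset (Fin.tail S), F (Fin.cons x t) := by
  have h := Finset.map_consEquiv_filter_piFinset S (fun _ => True)
  simp only [Finset.filter_true] at h
  rw [← Finset.sum_product', ← h, Finset.sum_map]
  refine Finset.sum_congr rfl fun j _ => ?_
  simp only [Equiv.toEmbedding_apply]
  congr 1
  exact ((Fin.consEquiv fun _ => α).apply_symm_apply j).symm

end Bookkeeping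

section SeveralDerivations

variable {R A : Type*} [CommRing R] [CommRing A] [Algebra R A]

/-- **Lemma 5.9 (1)**: `X^i.(Φ + Γ) = X^i.Φ + X^i.Γ` ("follows directly from linearity").
[cite: BergEtAl2024, Lemma 5.9 (1), p.28 (PDF p.29)] locator: paper:arxiv-2411.03444 p0029.txt:L62–L64 -/
theorem lemma_5_9_add {K : ℕ} (D : Fin K → Derivation R A A) (i : Fin K → ℕ) (a b : A) :
    (List.ofFn fun r => (D r : Module.End R A) ^ i r).prod (a + b) =
      (List.ofFn fun r => (D r : Module.End R A) ^ i r).prod a +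
        (List.ofFn fun r => (D r : Module.End R A) ^ i r).prod b :=
  map_add _ a b

/-- **Lemma 5.9 (2) — the iterated Leibniz rule for ordered monomials in several derivations.**
For derivations `D₀, …, D_{K−1}` of a commutative algebra and a multi-index `i ∈ ℕ^K`, the ordered
monomial `X^i = D₀^{i₀} ∘ ⋯ ∘ D_{K−1}^{i_{K−1}}` satisfies
`X^i (ab) = Σ_{i' ≤ i} (∏_r binom(i_r, i'_r)) · (X^{i'} a) (X^{i − i'} b)`.
[cite: BergEtAl2024, Lemma 5.9 (2), p.28 (PDF p.29)] locator: paper:arxiv-2411.03444 p0029.txt:L62–L80 -/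
theorem lemma_5_9 {K : ℕ} (D : Fin K → Derivation R A A) (i : Fin K → ℕ) (a b : A) :
    (List.ofFn fun r => (D r : Module.End R A) ^ i r).prod (a * b) =
      ∑ j ∈ Iic i, (∏ r, (i r).choose (j r)) •
        ((List.ofFn fun r => (D r : Module.End R A) ^ j r).prod a *
          (List.ofFn fun r => (D r : Module.End R A) ^ (i r - j r)).prod b) := by
  induction K with
  | zero =>
    have hI : Iic i = {i} := by
      ext j
      simp only [mem_Iic, mem_singleton]
      exact ⟨fun _ => Subsingleton.elim j i, fun h => h ▸ le_rfl⟩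
    simp [hI]
  | succ K ih =>
    -- peel off the outermost derivation `D 0`
    have hIH := ih (fun r => D r.succ) (fun r => i r.succ)
    rw [List.ofFn_succ, List.prod_cons, Module.End.mul_apply, hIH, map_sum]
    simp only [map_nsmul, derivation_pow_apply_mul (D 0) (i 0)]
    -- the target: split the box `Iic i` along the first coordinate
    have hbox : Iic i = Fintype.piFinset fun r => Iic (i r) := rfl
    rw [hbox, sum_piFinset_succ]
    -- antidiagonal ↔ first coordinate of the box
    have hIic : Iic (i 0) = range (i 0 + 1) := by
      ext x
      simp
    rw [hIic, sum_comm]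
    refine sum_congr rfl fun t _ => ?_
    rw [Nat.sum_antidiagonal_eq_sum_range_succ_mk, smul_sum]
    refine sum_congr rfl fun x _ => ?_
    rw [List.ofFn_succ, List.prod_cons, Module.End.mul_apply, List.ofFn_succ, List.prod_cons,
      Module.End.mul_apply, Fin.prod_univ_succ, smul_smul, mul_comm (∏ r : Fin K, _)]
    simp only [Fin.cons_zero, Fin.cons_succ]

end SeveralDerivations

end BergEtAl2024

end Literature.Barriers.ValiantsHypothesis
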